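import Literature.Probability.Percolation.LoopRotationInvarianceProofs
import HarnessLib

/-!
# Rotation invariance of the critical percolation loop ensemble — coupling form

Second layer of the decomposition of the named fact `dkkmo_rotation_invariance`
(`Literature.Probability.Percolation.LoopRotationInvariance`, **crit-perc.S25**;
Duminil-Copin–Kozlowski–Krachun–Manolescu–Oulamara, *Rotational invariance in critical planar
lattice models*, arXiv:2012.11672, Theorem 1.2 of v2 (2026) = the quantitative, angle-uniform
form; case `q = 1`).

DKKMO measure the distance between two laws `φ, φ'` of loop configurations by the coupling
distance (arXiv:2012.11672v2, eq. (2))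
`d_CN(φ, φ') = inf {ε : ∃ coupling P of φ, φ' with P[d_CN(ω, ω') > ε] < ε}`,
whereas the vendored statement `dkkmo_rotation_invariance` uses the prelude's proxy
`camiaNewmanEDist` = Mathlib's Lévy–Prokhorov edistance on `Measure (LoopSpace ℂ)`. This file

* proves the elementary half of the Strassen–Dudley theorem in the form needed here,
  `levyProkhorovEDist_le_of_coupling`: a coupling under which the two coordinates are `ε`-close
  outside a set of mass `≤ ε` bounds the Lévy–Prokhorov edistance by `ε` — stated for couplings
  realised on an arbitrary measurable space and **without any measurability assumption on the
  exceptional set** (outer measure), which matters because `LoopSpace ℂ` is not separable, so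
  closed sets of `LoopSpace ℂ × LoopSpace ℂ` need not be product-measurable;
* specialises it to crit-perc.S25: a coupling of two critical bond percolations `ω, ω'` on `ℤ²`
  (a measure on pairs of bond configurations with both marginals `bondPercolation (zdGraph 2) half`,
  as in the paper, where `ω ∼ φ_{δℤ²}` and `ω' ∼ φ_{e^{iα}δℤ²}` are coupled) under which the
  collections of interface loops of `ω` on `δℤ²` and of `ω'` on `δ e^{iα} ℤ²` inside
  `closedBall 0 R` are at Hausdorff edistance `> ε` with probability `≤ ε` bounds the
  Camia–Newman edistance of the two loop laws by `ε`
  (`camiaNewmanEDist_map_bondLoopCollection_le_of_coupling`: push the coupling forward to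
  `LoopSpace ℂ × LoopSpace ℂ` along the measurable loop-collection maps,
  `measurable_bondLoopCollection`), whence the reduction of crit-perc.S25 to Theorem 1.2 in the
  coupling form of eq. (2), `dkkmo_rotation_invariance_of_coupling` (explicit hypothesis).

No named fact lives in this file. The coupling form of Theorem 1.2 (`q = 1`) is equivalent to
crit-perc.S25 up to constants (this file's direction, and conversely Strassen's theorem for the
finitely supported loop laws), so it is not a separate proof obligation: it is *proved* from
DKKMO's Theorem 1.7 (`dkkmo_universality_coupling`, `IsoradialRectangularLoops`) in
`LoopRotationInvarianceCouplingProofs` (`dkkmo_coupling_of_universality`, the gluing argument of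
v1 §7.1 / v2 Remark 1.8), and crit-perc.S25 follows (`dkkmo_rotation_invariance_of_universality`
in `LoopRotationInvarianceAssembly`). What remains above is the percolation-theoretic content of
DKKMO (Theorems 1.7/1.9, §3–§4 of v2) together with the passage from the paper's `d_CN` (typed
unbased loops, soft window `B(0, 1/ε)`; `dkkmo_theorem_1_7` in `LoopRepresentation`) to the
prelude's conventions (`IsoradialRectangularLoopsBridge`).

## References

* H. Duminil-Copin, K. K. Kozlowski, D. Krachun, I. Manolescu, M. Oulamara, arXiv:2012.11672,
  v2 (2026): Theorem 1.2, eq. (1)–(2) (the metric `d_CN` on configurations and on laws).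
* R. M. Dudley, *Real Analysis and Probability*, Cambridge Univ. Press (2002), Thm 11.3.5 and
  Cor. 11.6.4 (Strassen–Dudley: Prokhorov distance vs. couplings; the direction used here is the
  trivial one).
-/

noncomputable section

open MeasureTheory Set
open scoped ENNReal

namespace Literature.Probability.Percolation

/-! ### Couplings bound the Lévy–Prokhorov edistance -/

section Coupling

variable {Ω Ω' : Type*} [MeasurableSpace Ω] [PseudoEMetricSpace Ω] [OpensMeasurableSpace Ω]
  [MeasurableSpace Ω']

/-- One half of the coupling bound: if `X, Y : Ω' → Ω` have laws `μ₁`, `μ₂` under `P` and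
`P {ε < edist X Y} ≤ ε`, then `μ₁ B ≤ μ₂ (B^{ε'}) + ε'` for every measurable `B` and every
`ε < ε' < ∞`. No measurability of `{ε < edist X Y}` is needed. (Dudley 2002, Thm 11.3.5.) [folklore] -/
theorem measure_le_thickening_add_of_coupling {μ₁ μ₂ : Measure Ω} (P : Measure Ω')
    {X Y : Ω' → Ω} (hX : AEMeasurable X P) (hY : AEMeasurable Y P) (h₁ : P.map X = μ₁)
    (h₂ : P.map Y = μ₂) {ε ε' : ℝ≥0∞} (hP : P {ω | ε < edist (X ω) (Y ω)} ≤ ε) (hlt : ε < ε')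
    (hlt_top : ε' < ∞) {B : Set Ω} (hB : MeasurableSet B) :
    μ₁ B ≤ μ₂ (Metric.thickening ε'.toReal B) + ε' := by
  calc μ₁ B = P (X ⁻¹' B) := by rw [← h₁, Measure.map_apply_of_aemeasurable hX hB]
    _ ≤ P ((X ⁻¹' B ∩ {ω | edist (X ω) (Y ω) ≤ ε}) ∪ {ω | ε < edist (X ω) (Y ω)}) := by
        refine measure_mono fun ω hω => ?_
        by_cases h : edist (X ω) (Y ω) ≤ ε
        · exact Or.inl ⟨hω, h⟩
        · exact Or.inr (not_le.1 h)
    _ ≤ P (X ⁻¹' B ∩ {ω | edist (X ω) (Y ω) ≤ ε}) + P {ω | ε < edist (X ω) (Y ω)} :=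
        measure_union_le _ _
    _ ≤ P (Y ⁻¹' Metric.thickening ε'.toReal B) + ε := by
        refine add_le_add (measure_mono ?_) hP
        rintro ω ⟨hω, hd⟩
        show Metric.infEDist (Y ω) B < ENNReal.ofReal ε'.toReal
        rw [ENNReal.ofReal_toReal hlt_top.ne]
        rw [Set.mem_setOf_eq, edist_comm] at hd
        exact (Metric.infEDist_le_edist_of_mem (mem_preimage.1 hω)).trans_lt (hd.trans_lt hlt)
    _ = μ₂ (Metric.thickening ε'.toReal B) + ε := by
        rw [← h₂, Measure.map_apply_of_aemeasurable hY Metric.isOpen_thickening.measurableSet]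
    _ ≤ μ₂ (Metric.thickening ε'.toReal B) + ε' := by gcongr

/-- **Couplings bound the Lévy–Prokhorov edistance** (the elementary direction of the
Strassen–Dudley theorem): if `X, Y : Ω' → Ω` are random elements on a common space `(Ω', P)`
with laws `μ = P ∘ X⁻¹`, `ν = P ∘ Y⁻¹`, at extended distance `> ε` only on a set of (outer)
`P`-measure `≤ ε`, then `levyProkhorovEDist μ ν ≤ ε` (the event is the strict one of DKKMO's
eq. (2), `P[d > ε] < ε`; the non-strict variant follows by monotonicity). This is how a bound on DKKMO's coupling
distance (arXiv:2012.11672v2, eq. (2)) yields a bound on the prelude's `camiaNewmanEDist`.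
(Dudley, *Real Analysis and Probability* (2002), Thm 11.3.5, Cor. 11.6.4.) [folklore] -/
theorem levyProkhorovEDist_le_of_coupling {μ ν : Measure Ω} (P : Measure Ω') {X Y : Ω' → Ω}
    (hX : AEMeasurable X P) (hY : AEMeasurable Y P) (h₁ : P.map X = μ) (h₂ : P.map Y = ν)
    {ε : ℝ≥0∞} (hP : P {ω | ε < edist (X ω) (Y ω)} ≤ ε) : levyProkhorovEDist μ ν ≤ ε := by
  refine levyProkhorovEDist_le_of_forall μ ν ε fun ε' B hlt hlt_top hB => ⟨?_, ?_⟩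
  · exact measure_le_thickening_add_of_coupling P hX hY h₁ h₂ hP hlt hlt_top hB
  · refine measure_le_thickening_add_of_coupling P hY hX h₂ h₁ ?_ hlt hlt_top hB
    simpa only [edist_comm] using hP

end Coupling

section CritPerc

open LatticeModels

/-! ### crit-perc.S25 from couplings of configurations -/

/-- **A configuration coupling bounds the Camia–Newman distance of the loop laws.** If two
critical bond percolations `ω, ω'` on `ℤ²` are coupled — a measure `P` on pairs of bond
configurations with both marginals `bondPercolation (zdGraph 2) half`, the second coordinate
being read on the rotated lattice — so that the Hausdorff edistance between the collection of
interface loops of `ω` on `δℤ²` inside `closedBall 0 R` and that of `ω'` on `δ e^{iα} ℤ²`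
exceeds `ε` (strictly: the event of DKKMO's eq. (2), `P[d_CN(ω, ω') > ε] < ε`) with (outer)
`P`-probability at most `ε`, then the Camia–Newman edistance (Lévy–Prokhorov proxy) between the
two loop laws is at most `ε`: push the coupling forward along the measurable loop-collection
maps (`measurable_bondLoopCollection`, `δ > 0`) and apply `levyProkhorovEDist_le_of_coupling`.
This is how a bound on the coupling distance of eq. (2) yields the bound of crit-perc.S25.
(DKKMO, arXiv:2012.11672v2, eq. (2); Dudley 2002, Thm 11.3.5.) [cite: arXiv201211672v2, eq. (2)] -/
theorem camiaNewmanEDist_map_bondLoopCollection_le_of_coupling {δ : ℝ} (hδ : 0 < δ) (α R : ℝ)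
    (P : Measure (BondConfig (Site 2) × BondConfig (Site 2)))
    (h₁ : P.map Prod.fst = bondPercolation (zdGraph 2) half)
    (h₂ : P.map Prod.snd = bondPercolation (zdGraph 2) half) {ε : ℝ≥0∞}
    (hP : P {p | ε < edist (bondLoopCollection δ 0 (Metric.closedBall 0 R) p.1)
      (bondLoopCollection δ α (Metric.closedBall 0 R) p.2)} ≤ ε) :
    RandomPlanarGeometry.camiaNewmanEDist
        ((bondPercolation (zdGraph 2) half).map (bondLoopCollection δ 0 (Metric.closedBall 0 R)))
        ((bondPercolation (zdGraph 2) half).map (bondLoopCollection δ α (Metric.closedBall 0 R))) ≤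
      ε := by
  have hb : Bornology.IsBounded (Metric.closedBall (0 : ℂ) R) := Metric.isBounded_closedBall
  have hm₀ := measurable_bondLoopCollection hδ 0 hb
  have hmα := measurable_bondLoopCollection hδ α hb
  refine levyProkhorovEDist_le_of_coupling P (hm₀.comp measurable_fst).aemeasurable
    (hmα.comp measurable_snd).aemeasurable ?_ ?_ hP
  · rw [← Measure.map_map hm₀ measurable_fst, h₁]
  · rw [← Measure.map_map hmα measurable_snd, h₂]

/-- **Reduction of crit-perc.S25 to Theorem 1.2 in the coupling form of eq. (2).** If for every
radius `R` there are constants `C` and `c > 0` such that for every angle `α` and mesh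
`δ ∈ (0, 1]` the configurations `ω ∼ φ_{δℤ²}` and `ω' ∼ φ_{e^{iα}δℤ²}` can be coupled with the
loop collections of `ω` on `δℤ²` and of `ω'` on `δ e^{iα} ℤ²` inside `closedBall 0 R` at
Hausdorff edistance `> C δ^c` only with probability `≤ C δ^c` — DKKMO's Theorem 1.2 (`q = 1`),
`d_CN(φ_{δℤ²}, φ_{e^{iα}δℤ²}) ≤ C δ^c` with `d_CN` on laws the coupling distance of eq. (2),
rendered in the conventions of crit-perc.S25 (based oriented loop classes, hard centred window,
Hausdorff edistance on `LoopSpace ℂ`) — then `dkkmo_rotation_invariance` holds with the same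
constants (`camiaNewmanEDist_map_bondLoopCollection_le_of_coupling`). The hypothesis is proved
from Theorem 1.7 (`dkkmo_universality_coupling`) as `dkkmo_coupling_of_universality` in
`LoopRotationInvarianceCouplingProofs`; it is deliberately not a named fact (equivalent to
crit-perc.S25 up to constants). (DKKMO, arXiv:2012.11672v2, Thm 1.2 and eq. (2); Dudley 2002,
Thm 11.3.5.) [cite: arXiv201211672v2, Thm 1.2, eq. (2)] -/
theorem dkkmo_rotation_invariance_of_coupling
    (h : ∀ (R : ℝ),
      ∃ C c : ℝ, 0 < c ∧ ∀ α : ℝ, ∀ δ ∈ Set.Ioc (0 : ℝ) 1,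
        ∃ P : Measure (BondConfig (Site 2) × BondConfig (Site 2)),
          P.map Prod.fst = bondPercolation (zdGraph 2) half ∧
          P.map Prod.snd = bondPercolation (zdGraph 2) half ∧
          P {p | ENNReal.ofReal (C * δ ^ c) <
              edist (bondLoopCollection δ 0 (Metric.closedBall 0 R) p.1)
                (bondLoopCollection δ α (Metric.closedBall 0 R) p.2)} ≤
            ENNReal.ofReal (C * δ ^ c)) :
    dkkmo_rotation_invariance := by
  intro R
  obtain ⟨C, c, hc, hR⟩ := h R
  refine ⟨C, c, hc, fun α δ hδ => ?_⟩
  obtain ⟨P, h₁, h₂, hP⟩ := hR α δ hδ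
  exact camiaNewmanEDist_map_bondLoopCollection_le_of_coupling hδ.1 α R P h₁ h₂ hP

end CritPerc

end Literature.Probability.Percolation

end
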